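import Literature.NumberTheory.EllipticCurves.BurungaleSkinnerTianWan2024.SupersingularTwistPPartOPEN
import Literature.NumberTheory.EllipticCurves.Selmer
import Literature.NumberTheory.EllipticCurves.BSDInvariants
import Literature.NumberTheory.EllipticCurves.BSDConductor
import Literature.NumberTheory.EllipticCurves.ComplexMultiplication
import HarnessLib

/-!
# Burungale–Skinner–Tian–Wan (arXiv:2409.01350v2, PREPRINT), §1: the introduction's theorems that the
# tree did not yet carry — Thm. 1.6 (rank-zero `p`-converse at supersingular `p`, with its twist
# clause), Thm. 1.7 (full BSD for the rank-zero quadratic-twist families of sixteen named curves),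
# Thm. 1.9 (`p`-part of BSD in analytic rank one at good ordinary `p` under (irr_ℚ) + (ram)) — typed
# as explicitly labelled OPEN hypotheses (claim-tagged `def … : Prop`, nothing asserted)

LITERATURE-TYPING LAYER (cell `bsd-littype`, seat `bsd-littype-01`; D-0088(4)). HONEST FRAMING: the
source is an UNREFEREED PREPRINT (arXiv v1 2024-09-02, v2 2024-09-11; arXiv listing re-read
2026-08-26: no journal reference, no DOI other than the arXiv one). Following the tree's standing
pattern for this paper (`SupersingularPPartOPEN.lean`: `thm15_pPart_OPEN`; Summits-side
`BurungaleSkinnerTianWan2024_thm13_OPEN`), every printed theorem below is ONE `def … : Prop` carrying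
`[claim: BurungaleSkinnerTianWan2024, status: under-review]` — an OPEN binder that downstream files may
take as an explicit hypothesis `(h : …_OPEN)` and must NEVER feed as a theorem; the only `theorem`s here
are bookkeeping (list data) and bridges "binder ⇒ the tree's `BSDp`" granted published facts by name.
Typed ≠ proved ≠ endorsed.

WHAT THE TREE ALREADY HAS (not restated; cite by name): Conj. 1.1 = BSD in ranks `0, 1`
(`WeierstrassCurve.BSDTriple`, `BSDp`); Conj. 1.2 = Kobayashi's signed main conjecture
(Summits-side `Summit.BirchSwinnertonDyer.Rank1Residual.Supersingular.KobayashiMainConjecture`);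
Thm. 1.3, semistable clause (Summits-side `…Supersingular.BurungaleSkinnerTianWan2024_thm13_OPEN`);
Thm. 1.5, both clauses (`thm15_pPart_OPEN`, `thm15_twist_pPart_OPEN`); Thm. 1.10 (`BSDSelmer.lean`:
`burungaleSkinnerTianWan_analyticRank_eq_one_of_selmerCorank_eq_one`, with the §12 proof architecture in
`BSDSelmerPConverse*.lean`). NOT TYPED HERE, with the reason (vocabulary the tree lacks — a typed GAP, not
a wall): the twist clause of Thm. 1.3 (its target `KobayashiMainConjecture` lives Summits-side, which a
Literature file may not import); Conj. 1.12 / Thm. 1.13 (Perrin-Riou's conjecture: no Beilinson–Kato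
class `z_E ∈ H¹(ℚ, V_pE)` object in the tree); Thm. 1.14 / Thm. 1.21, Conj. 1.16–1.18, Prop. 1.19 (the
two-variable zeta element `𝒵(E/L) ∈ H¹_{rel,∘}(O_L[1/p], T(1) ⊗̂ Λ_L)`, the regulator maps `Col_v`,
`Log_v̄`, the `Λ_L`-adic Selmer groups `X_·(E/L)`, `X_Gr(E/L)`: none of this `ℤ_p²`-Iwasawa vocabulary
exists in the tree). Part II (§10–§12) statements for elliptic curves are typed in the sibling file
`ApplicationsPartIIOPEN.lean`.

Source and locators. Text: arXiv v2 TeX e-print `zeta.tex` (held copy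
`run/shared/lean/pub/bsd-eis/audit-1-g4/bstw-arxiv-2409.01350v2.tex`, sha16 `5926f035551c636d`;
`\newtheorem{thm}{Theorem}[section]`, one counter shared by thm/cor/lem/prop/conj/defn/assumption/remark,
so the printed numbers below are those of the PDF: Thm. 1.6 = `\label{corB_thmA}` tex l.478, Thm. 1.7 =
`\label{nCM}` l.492 with Example 1 of §10.3.3 (`\label{exam}` l.7569; the paper's only `example`
environment, numbered on its own counter), Thm. 1.9 = `\label{corA'}` l.540), the held chunked text
`paper:arxiv-2409.01350` [corpus: p0004 (Thm. 1.6, 1.7), p0005 (Thm. 1.9), p0006 (§1.2.1 display (1.7) =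
TeX label (h4)), p0077 (Example 1)], and the PDF text
`run/shared/lean/pub/bsd-litref/bstw24/staging/bsd-litref-bstw24-ty/text/bstw24-v2-pages.json` for the
page numbers: Thm. 1.6 and Thm. 1.7 p. 4, Thm. 1.9 p. 5, Example 1 p. 90 (Thm. 1.3 p. 3, Thm. 1.5 p. 4,
Thm. 1.10 p. 5 as in the sibling files). Verbatim:

> **Theorem 1.6.** Let `E/ℚ` be a semistable elliptic curve, and `p > 2` a supersingular prime. If
> `p = 3`, suppose that (1.7) holds. Then `corank_{ℤ_p} Sel_{p^∞}(E/ℚ) = 0 ⟹ L(1, E/ℚ) ≠ 0`.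
> Moreover, the same holds for any quadratic twist `E^K` as in Theorem 1.3 [= "`E^K := E ⊗ χ_K` for
> `χ_K` the character associated to a quadratic field extension `K/ℚ` with discriminant coprime to
> `Np` and divisible only by primes of ordinary reduction for `E`"].
> **Theorem 1.7.** Let `E` be an elliptic curve of conductor `N` denoted by 46a1, 62a1, 66b1, 69a1,
> 77c1, 94a1, 105a1, 106d1, 114b1, 115a1, 118c1, 118d1, 141b1, 141c1, 141e1 or 142c1 in Cremona's
> labelling. Let `M > 1` be a square-free integer with `(M, N) = 1` and `E^M` the quadratic twist of
> `E` by the character associated to the extension `ℚ(√M)/ℚ`. Suppose that the following conditions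
> hold: (a) `L(1, E^M) ≠ 0`, and (b) `E` has ordinary reduction at the primes dividing `M`. Then the
> BSD conj. holds for `E^M`, i.e. `E^M(ℚ)` and `Ш(E^M)` are finite, and
> `L(1,E^M)/Ω_{E^M} = #Ш(E^M) · ∏_{ℓ∤∞} c_ℓ(E^M) / #E^M(ℚ)²_tor`. Moreover, the conditions (a) and (b)
> are satisfied by infinitely many `M`. [proof: "based on Theorem 1.5 and prior work on the `p`-part
> of the BSD formula. The existence of infinitely many `M` … relies on [CLZ, Zi]."]
> **Theorem 1.9.** Let `E/ℚ` be an elliptic curve of conductor `N`, and `p ∤ 2N` an ordinary prime.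
> Suppose that the following holds. (irr_ℚ) The mod `p` Galois representation
> `ρ̄ : G_ℚ → Aut_{𝔽_p} E[p]` is absolutely irreducible. (ram) There exists a prime `ℓ ∥ N` such that
> `ρ̄` is ramified at `ℓ`. If `ord_{s=1} L(s, E/ℚ) = 1`, then the `p`-part of the BSD formula holds,
> i.e. `|L'(1,E/ℚ)/(Ω_E R(E/ℚ))|_p^{-1} = |#Ш(E/ℚ) · ∏_{q∣N} c_q(E/ℚ)|_p^{-1}`.

with (§1.2.1, display (1.7) = TeX (h4)) "`a_p(E) := p + 1 − #E(𝔽_p) = 0` … automatic for `p ≥ 5`",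
and `|p|_p = 1/p` (Conj. 1.1).

Transcription (the tree dictionary of the sibling files, nothing new): `W`, `W₀` globally minimal
models (`Ω_E = W.realPeriodRat`, `a_p = W.frobeniusTrace p`); semistable = `Semistable`; "`p > 2`
supersingular" = `p ≠ 2 ∧ GoodSS W p`; "(1.7) if `p = 3`" = `p = 3 → a_3 = 0`; "`p ∤ 2N` ordinary" =
`p ≠ 2 ∧ GoodOrd W p`; `corank_{ℤ_p} Sel_{p^∞}(E/ℚ) = W.selmerCorank p`; `L(1,E) ≠ 0` =
`W.entireLFunction 1 ≠ 0`; (irr_ℚ) = `Irr W p` (for the odd two-dimensional `ρ̄` at odd `p`,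
irreducible ⟺ absolutely irreducible — complex conjugation has the distinct eigenvalues `±1`; the tree
records the same reading in `Cha2005/ShaStructureIrreducible.lean`); (ram) = `Ram W p` (Tate curve: for
`ℓ ∥ N`, `ρ̄` ramified at `ℓ` iff `p ∤ v_ℓ(Δ_min)` — the transcription used for Thm. 1.10 in
`BSDSelmer.lean`); the twist datum exactly as in `thm15_twist_pPart_OPEN` (`RamifiedInQuadratic`);
"`ord_{s=1} L = 1`" = `W.analyticRank = 1`, then `L'(1,E) = W.leadingLCoeff`; the `p`-part display =
the NO-TORSION print shape of `Rank1Residual.PrintShape` (`∃ q : ℚ, L'/(Ω·Reg) = q ∧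
ord_p q = ord_p #Ш + ord_p ∏ c_ℓ`); "the BSD conj. holds for `E^M`" = `W.BSDTriple` for a globally
minimal model `W` of `E^M` (RANK ∧ SHAFIN ∧ LEAD of `BSDInvariants`; in analytic rank `0` LEAD is the
printed display `L(1)/Ω = #Ш·∏c/#tors²` with `Reg = 1`, the precedent being the tree's
`bsdTriple_of_hasCM_of_L_one_ne_zero`); the sixteen curves = their Cremona reduced minimal models
`[a₁,a₂,a₃,a₄,a₆]` (data of record: the tree's `KuriharaCertificates/RecordsN000011to000109.lean`
headers, Cremona's table), their global minimality and smoothness taken as BINDERS (no `instance` in a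
statement file); "`(M, N) = 1`" = `Nat.Coprime M (W₀.conductorNorm ℤ)`; (b) = every prime `q ∣ M` is
`GoodOrd W₀ q` (good, as `(M,N) = 1`, and ordinary).
-/

set_option autoImplicit false

noncomputable section

open scoped Classical

open WeierstrassCurve Literature.NumberTheory.EllipticCurves
  Literature.NumberTheory.EllipticCurves.Rank1Residual

namespace Literature.NumberTheory.EllipticCurves.BurungaleSkinnerTianWan2024

/-! ### Thm. 1.6 — the rank-zero `p`-converse at a supersingular prime (semistable clause, twist clause) -/

/-- **OPEN HYPOTHESIS — UNREFEREED PREPRINT (arXiv:2409.01350v2), Thm. 1.6, semistable clause.**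
"Let `E/ℚ` be a semistable elliptic curve, and `p > 2` a supersingular prime. If `p = 3`, suppose
that (1.7) [`a_3 = 0`] holds. Then `corank_{ℤ_p} Sel_{p^∞}(E/ℚ) = 0 ⟹ L(1, E/ℚ) ≠ 0`."
Transcribed for a globally minimal `W`: `p ≠ 2`, `Semistable W`, `GoodSS W p`, `p = 3 → a_3 = 0`,
`W.selmerCorank p = 0` ⇒ `W.entireLFunction 1 ≠ 0`. NEVER cite this `Prop` as a theorem; take it as an
explicit hypothesis. [claim: BurungaleSkinnerTianWan2024, status: under-review]
[cite: BurungaleSkinnerTianWan2024, Thm. 1.6 (p. 4; label corB_thmA, tex l.478; ANNOUNCED, typed as an OPEN hypothesis, nothing asserted)] -/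
def thm16_rankZeroPConverse_OPEN : Prop :=
  ∀ (W : WeierstrassCurve ℚ) [W.IsElliptic] [W.IsGloballyMinimal] (p : ℕ) [Fact p.Prime],
    p ≠ 2 → Semistable W → GoodSS W p → (p = 3 → W.frobeniusTrace 3 = 0) →
      W.selmerCorank p = 0 → W.entireLFunction 1 ≠ 0

/-- **OPEN HYPOTHESIS — UNREFEREED PREPRINT (arXiv:2409.01350v2), Thm. 1.6, twist clause.**
"… Moreover, the same holds for any quadratic twist `E^K` as in Theorem 1.3" — `E^K := E ⊗ χ_K`,
`K/ℚ` quadratic with discriminant coprime to `Np` and divisible only by primes of ordinary reduction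
for `E`. Transcribed with the twist datum of `thm15_twist_pPart_OPEN`: `W₀` globally minimal,
`p ≠ 2`, `Semistable W₀`, `GoodSS W₀ p`, `p = 3 → a_3(W₀) = 0`; `d` square-free, `d ≠ 1`, every prime
ramified in `ℚ(√d)` (`RamifiedInQuadratic d q`) is `≠ p` and `GoodOrd W₀ q`; `W` globally minimal with
`C • W = W₀.quadraticTwist d`; then `W.selmerCorank p = 0 ⇒ W.entireLFunction 1 ≠ 0`. NEVER cite this
`Prop` as a theorem. [claim: BurungaleSkinnerTianWan2024, status: under-review]
[cite: BurungaleSkinnerTianWan2024, Thm. 1.6 with Thm. 1.3 (twist clause; pp. 3–4; label corB_thmA, tex l.478; ANNOUNCED, OPEN binder)] -/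
def thm16_twist_rankZeroPConverse_OPEN : Prop :=
  ∀ (W₀ W : WeierstrassCurve ℚ) [W₀.IsElliptic] [W₀.IsGloballyMinimal] [W.IsElliptic]
    [W.IsGloballyMinimal] (p : ℕ) [Fact p.Prime] (d : ℤ) (C : VariableChange ℚ),
    p ≠ 2 → Semistable W₀ → GoodSS W₀ p → (p = 3 → W₀.frobeniusTrace 3 = 0) →
    Squarefree d → d ≠ 1 →
    (∀ (q : ℕ) [Fact q.Prime], RamifiedInQuadratic d q → q ≠ p ∧ GoodOrd W₀ q) →
    C • W = W₀.quadraticTwist (d : ℚ) →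
    W.selmerCorank p = 0 → W.entireLFunction 1 ≠ 0

/-- Bookkeeping bridge for Thm. 1.6: granted the OPEN binder, `corank Sel_{p^∞}(E/ℚ) = 0` at such a
pair forces analytic rank `0` (`ord_{s=1} L(E,s) = 0 ⟸ L(E,1) ≠ 0`, by the definition of the order of
vanishing). CONDITIONAL; closes nothing. [claim: BurungaleSkinnerTianWan2024, status: under-review]
[cite: BurungaleSkinnerTianWan2024, Thm. 1.6 (p. 4; OPEN binder)] -/
theorem analyticRank_eq_zero_of_thm16_OPEN (h : thm16_rankZeroPConverse_OPEN)
    (W : WeierstrassCurve ℚ) [W.IsElliptic] [W.IsGloballyMinimal] (p : ℕ) [Fact p.Prime]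
    (hp : p ≠ 2) (hsst : Semistable W) (hss : GoodSS W p) (h4 : p = 3 → W.frobeniusTrace 3 = 0)
    (hsel : W.selmerCorank p = 0) : W.analyticRank = 0 :=
  analyticRank_eq_zero_of_entireLFunction_one_ne_zero W (h W p hp hsst hss h4 hsel)

/-! ### Thm. 1.7 — full BSD for the rank-zero quadratic-twist families of sixteen curves -/

/-- The sixteen curves of Thm. 1.7 (= Example 1 of §10.3.3, p. 90), as their Cremona reduced minimal models
`⟨a₁, a₂, a₃, a₄, a₆⟩`, in the printed order: 46a1 `[1,-1,0,-10,-12]`, 62a1 `[1,-1,1,-1,1]`,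
66b1 `[1,1,1,-2,-1]`, 69a1 `[1,0,1,-1,-1]`, 77c1 `[1,1,0,4,11]`, 94a1 `[1,-1,1,0,-1]`,
105a1 `[1,0,1,-3,1]`, 106d1 `[1,1,0,-27,-67]`, 114b1 `[1,1,0,-95,-399]`, 115a1 `[0,0,1,7,-11]`,
118c1 `[1,1,1,-4,-5]`, 118d1 `[1,1,0,56,-192]`, 141b1 `[1,1,1,-8,-16]`, 141c1 `[1,0,0,-2,3]`,
141e1 `[0,1,1,-26,-61]`, 142c1 `[1,-1,0,-1,-3]` (conductor = the number in the label; all sixteen are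
semistable of Mordell–Weil rank `0`). The `a`-invariants are Cremona's (data of record, as carried by
the tree's `KuriharaCertificates/RecordsN000011to000109.lean`); the paper names the curves by label only.
[cite: BurungaleSkinnerTianWan2024, Thm. 1.7 (p. 4) and Example 1 (p. 90) (labels nCM / exam, tex l.492 / l.7569)]
[cite: CremonaAlgorithms1997, Table 1 (curves 46A1–142C1: the a-invariants)] -/
def thm17Curves : List (WeierstrassCurve ℚ) :=
  [⟨1, -1, 0, -10, -12⟩, ⟨1, -1, 1, -1, 1⟩, ⟨1, 1, 1, -2, -1⟩, ⟨1, 0, 1, -1, -1⟩, ⟨1, 1, 0, 4, 11⟩,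
    ⟨1, -1, 1, 0, -1⟩, ⟨1, 0, 1, -3, 1⟩, ⟨1, 1, 0, -27, -67⟩, ⟨1, 1, 0, -95, -399⟩, ⟨0, 0, 1, 7, -11⟩,
    ⟨1, 1, 1, -4, -5⟩, ⟨1, 1, 0, 56, -192⟩, ⟨1, 1, 1, -8, -16⟩, ⟨1, 0, 0, -2, 3⟩, ⟨0, 1, 1, -26, -61⟩,
    ⟨1, -1, 0, -1, -3⟩]

/-- There are sixteen curves in the list of Thm. 1.7. Bookkeeping.
[cite: BurungaleSkinnerTianWan2024, Thm. 1.7 (p. 4; label nCM, tex l.492)] -/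
theorem thm17Curves_length : thm17Curves.length = 16 := rfl

/-- Each listed Weierstrass model is smooth (`Δ ≠ 0`), so the binder `[W₀.IsElliptic]` in
`thm17_fullBSD_twistFamilies_OPEN` is inhabited; the discriminants are, in order, `−2⁵·23`, `−2⁴·31`,
`−2²·3⁶·11` … (Cremona's Table 1). Non-vacuity check, by evaluation of `Δ` in `ℚ`.
[cite: CremonaAlgorithms1997, Table 1 (curves 46A1–142C1)] -/
theorem delta_ne_zero_of_mem_thm17Curves : ∀ W ∈ thm17Curves, W.Δ ≠ 0 := by
  simp only [thm17Curves, List.mem_cons, List.mem_nil_iff, or_false]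
  rintro W (rfl | rfl | rfl | rfl | rfl | rfl | rfl | rfl | rfl | rfl | rfl | rfl | rfl | rfl | rfl | rfl) <;>
    norm_num [WeierstrassCurve.Δ, WeierstrassCurve.b₂, WeierstrassCurve.b₄, WeierstrassCurve.b₆,
      WeierstrassCurve.b₈]

/-- **OPEN HYPOTHESIS — UNREFEREED PREPRINT (arXiv:2409.01350v2), Thm. 1.7 (full BSD clause).**
"Let `E` be [one of the sixteen curves of `thm17Curves`] of conductor `N`. Let `M > 1` be a square-free
integer with `(M,N) = 1` and `E^M` the quadratic twist of `E` by the character associated to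
`ℚ(√M)/ℚ`. Suppose (a) `L(1,E^M) ≠ 0`, and (b) `E` has ordinary reduction at the primes dividing `M`.
Then [BSD] holds for `E^M`, i.e. `E^M(ℚ)` and `Ш(E^M)` are finite, and
`L(1,E^M)/Ω_{E^M} = #Ш(E^M)·∏_{ℓ∤∞} c_ℓ(E^M)/#E^M(ℚ)²_tor`." Transcribed: `W₀ ∈ thm17Curves` with its
smoothness and global minimality as binders; `M : ℕ`, `1 < M`, `Squarefree M`,
`Nat.Coprime M (W₀.conductorNorm ℤ)`; (b) = every prime `q ∣ M` is good ordinary for `W₀`; `W` a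
globally minimal model of `E^M` (`C • W = W₀.quadraticTwist M`); (a) = `W.entireLFunction 1 ≠ 0`;
conclusion = `W.BSDTriple` (RANK ∧ SHAFIN ∧ LEAD; with `r_an = 0` this is the printed display, `Reg = 1`).
The proof in print rests on Thm. 1.5 (itself the OPEN binder `thm15_pPart_OPEN`) via Thm. 10.12
(sibling `ApplicationsPartIIOPEN.lean`: `thm1012_fullBSD_rankZeroTwists_OPEN`).
NEVER cite this `Prop` as a theorem. [claim: BurungaleSkinnerTianWan2024, status: under-review]
[cite: BurungaleSkinnerTianWan2024, Thm. 1.7 (p. 4; label nCM, tex l.492) with Example 1 (p. 90) (ANNOUNCED, OPEN binder)] -/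
def thm17_fullBSD_twistFamilies_OPEN : Prop :=
  ∀ W₀ ∈ thm17Curves, ∀ [W₀.IsElliptic] [W₀.IsGloballyMinimal] (M : ℕ) (W : WeierstrassCurve ℚ)
    [W.IsElliptic] [W.IsGloballyMinimal] (C : VariableChange ℚ),
    1 < M → Squarefree M → Nat.Coprime M (W₀.conductorNorm ℤ) →
    (∀ q : ℕ, (hq : q.Prime) → q ∣ M → (haveI : Fact q.Prime := ⟨hq⟩; GoodOrd W₀ q)) →
    C • W = W₀.quadraticTwist (M : ℚ) →
    W.entireLFunction 1 ≠ 0 → W.BSDTriple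

/-- **OPEN HYPOTHESIS — UNREFEREED PREPRINT (arXiv:2409.01350v2), Thm. 1.7 ("infinitely many `M`"
clause).** "Moreover, the conditions (a) and (b) are satisfied by infinitely many `M`" (for each of the
sixteen curves; "relies on [CLZ, Zi]" = Cai–Li–Zhai and Zhai, via Example 1 (p. 90): [CLZ, Thm. 1.5] for
46a1, 69a1, 77c1, 94a1, 114b1, 141b1, 142c1 and [Zi, Thm. 1] for the other nine). Transcribed: for each
`W₀ ∈ thm17Curves` (smooth, globally minimal — binders) the set of square-free `M > 1` coprime to `N`
with (b) and with SOME globally minimal model `W` of `E^M` having `L(1, E^M) ≠ 0` is infinite.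
NEVER cite this `Prop` as a theorem. [claim: BurungaleSkinnerTianWan2024, status: under-review]
[cite: BurungaleSkinnerTianWan2024, Thm. 1.7, last sentence (p. 4; label nCM, tex l.492; ANNOUNCED, OPEN binder)] -/
def thm17_infinitelyManyTwists_OPEN : Prop :=
  ∀ W₀ ∈ thm17Curves, ∀ [W₀.IsElliptic] [W₀.IsGloballyMinimal],
    {M : ℕ | 1 < M ∧ Squarefree M ∧ Nat.Coprime M (W₀.conductorNorm ℤ) ∧
      (∀ q : ℕ, (hq : q.Prime) → q ∣ M → (haveI : Fact q.Prime := ⟨hq⟩; GoodOrd W₀ q)) ∧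
      ∃ (W : WeierstrassCurve ℚ) (_ : W.IsElliptic) (_ : W.IsGloballyMinimal) (C : VariableChange ℚ),
        C • W = W₀.quadraticTwist (M : ℚ) ∧ W.entireLFunction 1 ≠ 0}.Infinite

/-- Reading the two clauses of Thm. 1.7 together: granted both OPEN binders, each of the sixteen
curves has infinitely many square-free `M > 1` for which SOME globally minimal model of `E^M` satisfies
the full BSD triple. Bookkeeping (the quantifier bookkeeping the printed "Moreover" sentence leaves
implicit). CONDITIONAL; closes nothing. [claim: BurungaleSkinnerTianWan2024, status: under-review]
[cite: BurungaleSkinnerTianWan2024, Thm. 1.7 (p. 4; OPEN binders)] -/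
theorem infinite_bsdTriple_twists_of_thm17_OPEN (h : thm17_fullBSD_twistFamilies_OPEN)
    (hinf : thm17_infinitelyManyTwists_OPEN) (W₀ : WeierstrassCurve ℚ) (hW₀ : W₀ ∈ thm17Curves)
    [W₀.IsElliptic] [W₀.IsGloballyMinimal] :
    {M : ℕ | 1 < M ∧ Squarefree M ∧
      ∃ (W : WeierstrassCurve ℚ) (_ : W.IsElliptic) (_ : W.IsGloballyMinimal) (C : VariableChange ℚ),
        C • W = W₀.quadraticTwist (M : ℚ) ∧ W.BSDTriple}.Infinite := by
  refine (hinf W₀ hW₀).mono ?_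
  rintro M ⟨hM, hsq, hcop, hord, W, hE, hmin, C, hC, hL⟩
  exact ⟨hM, hsq, W, hE, hmin, C, hC, h W₀ hW₀ M W C hM hsq hcop hord hC hL⟩

/-! ### Thm. 1.9 — the `p`-part of BSD in analytic rank one at a good ordinary prime -/

/-- **OPEN HYPOTHESIS — UNREFEREED PREPRINT (arXiv:2409.01350v2), Thm. 1.9.** "Let `E/ℚ` be an
elliptic curve of conductor `N`, and `p ∤ 2N` an ordinary prime. Suppose that the following holds.
(irr_ℚ) The mod `p` Galois representation `ρ̄ : G_ℚ → Aut_{𝔽_p} E[p]` is absolutely irreducible.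
(ram) There exists a prime `ℓ ∥ N` such that `ρ̄` is ramified at `ℓ`. If `ord_{s=1} L(s,E/ℚ) = 1`,
then the `p`-part of the BSD formula holds, i.e.
`|L'(1,E/ℚ)/(Ω_E R(E/ℚ))|_p^{-1} = |#Ш(E/ℚ)·∏_{q∣N} c_q(E/ℚ)|_p^{-1}`." Transcribed for a globally
minimal `W`: `p ≠ 2`, `GoodOrd W p`, `Irr W p`, `Ram W p`, `W.analyticRank = 1` ⇒ the no-torsion print
shape at `p` (`L'(E,1)/(Ω·Reg) = q ∈ ℚ`, `ord_p q = ord_p #Ш + ord_p ∏ c_ℓ`). No semistability, no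
restriction on `p ∣ c_q`, no surjectivity: this is the hypothesis set of Thm. 11.12 (ordinary case,
p. 94) of the same paper, of which Thm. 1.9 is the elliptic-curve instance (sibling file:
`thm19_of_thm1112_OPEN`). NEVER cite this `Prop` as a theorem.
[claim: BurungaleSkinnerTianWan2024, status: under-review]
[cite: BurungaleSkinnerTianWan2024, Thm. 1.9 (p. 5; label corA', tex l.540; ANNOUNCED, OPEN binder)] -/
def thm19_pPart_rankOne_ordinary_OPEN : Prop :=
  ∀ (W : WeierstrassCurve ℚ) [W.IsElliptic] [W.IsGloballyMinimal] (p : ℕ) [Fact p.Prime],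
    p ≠ 2 → GoodOrd W p → Irr W p → Ram W p → W.analyticRank = 1 →
      ∃ q : ℚ, W.leadingLCoeff / ((W.realPeriodRat * W.regulator : ℝ) : ℂ) = (q : ℂ) ∧
        padicValRat p q = (padicValNat p W.shaOrder : ℤ) + padicValNat p W.tamagawaProduct

/-- **Bridge for Thm. 1.9 (CONDITIONAL).** IF the announced Thm. 1.9 (`hBSTW_OPEN`, unrefereed) holds,
then at every pair `(E, p)` with `p` odd good ordinary, `E[p]` irreducible, a ramified multiplicative
prime, and analytic rank `1`, Miller's `BSD(E,p)` follows — via the tree's bridge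
`bsdp_of_padicVal_printShape` (Gross–Zagier–Kolyvagin `hGZK` by name). Closes nothing.
[claim: BurungaleSkinnerTianWan2024, status: under-review] [cite: Miller2011LMS, §1 and Def. 1.1] -/
theorem bsdp_of_thm19_OPEN (hBSTW_OPEN : thm19_pPart_rankOne_ordinary_OPEN)
    (hGZK : rank_eq_analyticRank_of_analyticRank_le_one)
    (W : WeierstrassCurve ℚ) [W.IsElliptic] [W.IsGloballyMinimal] (p : ℕ) [Fact p.Prime]
    (hp : p ≠ 2) (hord : GoodOrd W p) (hirr : Irr W p) (hram : Ram W p) (h1 : W.analyticRank = 1) :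
    BSDp W p :=
  bsdp_of_padicVal_printShape W p hGZK h1.le hirr (hBSTW_OPEN W p hp hord hirr hram h1)

end Literature.NumberTheory.EllipticCurves.BurungaleSkinnerTianWan2024

end
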